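import Summits.HodgeConjecture.HodgeConjecture.Theorems.F0P3cDbTThetaRoadW1 -- ★ p850793: the (O2θ-W1) binder currency (theta types, Keys labels, signed packet, transfer)
import Literature.NumberTheory.Rogawski1990.Ch1   -- ★ `Ch1.characterLocallyIntegrable` (junction E3)
import HarnessLib

/-!
# K2_E2 «WeilCharacterThetaRoad» — `_Sigs`: the FIRST-20-FILES signature skeleton of programme P7 (ENGINE E2), EDITION 4 (ED. 3 923f7de1e6bfc1f8 @ 700995e33418; ED. 4 = K2E2-r01 BOX 27 FIX 1 — row S4 re-stated at NON-SPLIT `v` with `hH`, `hHd`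
(REPAIR A; at a split `v` the centre `≅ (L⁺_v)ˣ` is non-compact and the old statement was false) — + NIT 1 (orientation notes) + NIT 2 (heartbeats dropped on the short rows) + lit1 (5233)
`Deligne1976` locator; ED. 3 MOVED rows D1, D2, D4 into tier 0 ED. 2 as
the sockets `stub_nonL2ConstituentIsPiN` ∕ `stub_thetaTypeUnique` ∕ `stub_thetaTypeWittClassInvariant` (token-identical statements; the composition
`piNOtherTowerThetaType_of_bricks : (D1) → (D2) → (D4) → (D)` is kernel-checked there, TRIO) — they are no longer duplicated here)

Unit `hodgecm-mathlib-K2E2-plan` g3 · socket item `stmt-HodgeConjecture-24833` · companion of tier 0∕1 `Lines/K2_E2_WeilCharacterThetaRoad.lean` (ED. 1 8ec3b18c1f83e4ba @ 86d577ccd0ab)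
and of the card `Lines/K2_E2_WeilCharacterThetaRoad.md` (the full 20-row table with AUDIT locators, sizes, dependency map and price).  One `theorem sig_<File> : ‹statement› := by sorry`
per planned file WHOSE STATEMENT IS TYPABLE OVER EXISTING DECLARATIONS TODAY (rows D3, T3, S4, J1 below; D1, D2, D4 live in tier 0 since ED. 3); the remaining planned files (Weil-character formula W1–W3, Weyl integration
T1–T2, the stabilisation identities S1–S3, the depth-zero rung R) need definitions the tree lacks (`weilCharacterKernel`, a Cartan census of `U(H)(L⁺_v)`) and are listed in §3 as
DEF-REQUEST rows with their intended signatures in words — they are NOT typed as vacuous placeholders.  This edition imports ONLY built ★ modules (tier 0 has no olean until its KICK);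
the composition (D) ⇐ D1+D2+D4+★ IS tier 0 ED. 2's `piNOtherTowerThetaType_of_bricks`; (S) ⇐ S1+…+S4, (T) ⇐ T1+T2+T3 would come after a build, if those roads are ever dealt (R21: NOT DEALT).  Every row is E2-local unless marked; no row restates
(O2θ-W1), PK, or a refuted statement (`ledger negatives`: none of HodgeConjecture's negatives concerns local characters).

HONEST LABEL: HC_CM is proved only modulo the 7 printed citations (2 remaining named inputs: hLiu418 = stmt-HodgeConjecture-24832, h413 = stmt-HodgeConjecture-24833) until rung 0
closes.  This file proves nothing printed (statements + `sorry`); count-neutral.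

[cite: GelbartRogawski1991, §5.1 Lem. 5.1.2 p. 466] [cite: Rogawski1990, §12.2 pp. 173–174; §13.1 Prop. 13.1.4 p. 199; §4.3 p. 43] [cite: HarrisKudlaSweet1996, Thm. 6.1 p. 967]
[cite: Casselman1977, Thm. 5.2] [cite: Deligne1976, Théorème p. A155] [cite: HarishChandra1999, Thm. 16.3] [cite: Liu2021, Def. 4.11]
-/

set_option autoImplicit false

set_option linter.dupNamespace false

noncomputable section

open NumberField IsDedekindDomain MeasureTheory
open scoped Matrix ComplexOrder

namespace Summit.HodgeConjecture.HodgeConjecture.Cruxes.H413.K2E2WeilCharacterThetaRoad.Sigs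

open Literature.NumberTheory Literature.NumberTheory.Automorphic Literature.NumberTheory.Automorphic.UnitaryGroup
open Literature.NumberTheory.Automorphic.IdeleClassGroup
open Literature.NumberTheory.Automorphic.Liu2021 Literature.NumberTheory.Automorphic.Liu2021.Def411WeilCarriers
open Literature.NumberTheory.GaloisRepresentations
open Literature.NumberTheory.Rogawski1990 Literature.NumberTheory.GelbartRogawski1991

/-! ## §1 The (D)-road's converse rigidity D3 (kept for the (Σ)-side; the bricks D1, D2, D4 of (D) are tier-0 sockets since ED. 3: (D) ⇐ ★ `.pin` + D1 + D2 + D4 + ★ GLUE «Ne», kernel-checked there) -/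

set_option synthInstance.maxHeartbeats 400000 in
/-- **D3 `K2E2WThetaTypeLineRigidity` (support, M, in-house)** — «the theta type remembers its line modulo norms»: if ONE class is the CM theta type at two lines `⟨ε₁⟩`,
`⟨ε₂⟩` (same `μ, χ_f`, same frame), then `ε₂ ε₁⁻¹ ∈ N(L_v^×)` (the tree's non-norm currency of ★ `u1Disjoint_of_letters`, token for token).  Print: theta DICHOTOMY — the lifts of
one character from the two INEQUIVALENT hermitian lines are distinct [GelbartRogawski1991 Lem. 5.1.2 p. 466 «ψ_v ranges over a set of representatives … modulo N_{E/F}(E_v^*)»;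
HarrisKudlaSweet1996 Thm. 6.1 (b) p. 967 at n = 1].  In-house: ★ `nonempty_equiv_of_thetaTypeAtCM` twice ⇒ `X_v(ε₁) ≅ X_v(ε₂)` on `U(diag dV)(L⁺_v)` (transport along ★
`localCongr`) ⇒ ★ `F0P2oXThetaLineRigidity.exists_mul_conj_eq_ratio_of_areIsomorphicRep_xThetaCM` (stated at `e₁ = Equiv.prodUnique`; the general `e₁` is a reindexing of the
doubled space — the only genuinely new step, S–M).  ORIENTATION (BOX 27 NIT 1): the ratio is written `ε₂ ε₁⁻¹`; tier 0's (Σ)∕(D) use `ε₁ ε₂⁻¹` ∕ `ε₁ ε⁻¹` — norms form a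
subgroup, so either orientation serves ((D4)'s `ε₂ ε₁⁻¹` composes literally with (D)'s `εn ε⁻¹` in tier 0's `piNOtherTowerThetaType_of_bricks`).  Why it might fail: the `e₁`-transport (if ★ `xThetaCM` depended on `e₁` beyond reindexing — it does not by ★ `Def411WeilCarriers`).
[cite: GelbartRogawski1991, Lem. 5.1.2 p. 466] [cite: HarrisKudlaSweet1996, Thm. 6.1 p. 967] -/
theorem sig_K2E2WThetaTypeLineRigidity :
    ∀ (L : Type) [Field L] [NumberField L] [IsCMField L] (H : Matrix (Fin 3) (Fin 3) L) {n' : ℕ} (e₁ : Fin 3 × Fin 1 ≃ Fin n')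
    (dV : Fin 3 → L) (hdV : ∀ i, IsCMField.complexConj L (dV i) = dV i) (hdV0 : ∀ i, dV i ≠ 0) (g : GL (Fin 3) L)
    (hg : ((g : Matrix (Fin 3) (Fin 3) L).map (cmConjRingHom L))ᵀ * H * (g : Matrix (Fin 3) (Fin 3) L) = Matrix.diagonal dV)
    (μ : Literature.NumberTheory.Automorphic.IdeleClassGroup L →ₜ* Circle) (hμ : IsConjugateSymplectic L μ)
    (χf : UnitaryGroup.finAdelicOne (↥(maximalRealSubfield L)) L (IsCMField.complexConj L) →* ℂˣ),
    Continuous χf → (∀ z, ‖((χf z : ℂˣ) : ℂ)‖ = 1) →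
    ∀ (v : HeightOneSpectrum (𝓞 ↥(maximalRealSubfield L))), (∀ w : PlacesOver L v, IsCMField.complexConj L • w.1 = w.1) →
    ∀ (ε₁ ε₂ : (↥(maximalRealSubfield L))ˣ) (c : IrrClass ((cmDatum L 3 H).Local v)),
      ThetaTypeAtCM L H e₁ dV hdV hdV0 g hg μ hμ χf ε₁ v c → ThetaTypeAtCM L H e₁ dV hdV hdV0 g hg μ hμ χf ε₂ v c →
      ∃ x : (LocalRing L v)ˣ, (x : LocalRing L v) * conjLocal L (IsCMField.complexConj L) v x =
        algebraMap L (LocalRing L v) (((ε₂ * ε₁⁻¹ : (↥(maximalRealSubfield L))ˣ) : ↥(maximalRealSubfield L)) : L) := by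
  sorry


/-! ## §2 The (T)-road and the (S)-road: the rows typable today -/

set_option synthInstance.maxHeartbeats 400000 in
-- scoped heartbeat raise: elaboration of the 60-line (O2θ-W1) binder block (instance-heavy), not proof search.
set_option maxHeartbeats 4000000 in
/-- **T3 `K2E2WHSideIndependence` (crux-sized, M–L, E2∕E3-local)** — «the `ξ_v`-side of (13.1.4) does not depend on the chosen matching partner»: for two `Δ‴`-transfers `fH`,
`fH'` of the same test function `f`, `∫_{H_v} ξ_v·fH = ∫_{H_v} ξ_v·fH'`.  This is the well-definedness half of (T) (a transfer is pinned only through its STABLE orbital integrals on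
the `G`-regular set [Rogawski1990 §4.3 (4.3.1) p. 43]); mechanism: Weyl integration on `H_v = U(2)×U(1)(L⁺_v)` [HarishChandra1999 §§4–5; Rogawski1990 §4.9] + the `G`-regular
set is conull + `ξ_v` (one-dimensional) is constant on stable classes.  Why it might fail: `IsLocalDeltaTransfer` fixes the orbital integrals w.r.t. the orbital-measure families
`mH v`, tied to `νH v` only through the canonicity hypothesis of the prefix (present: `hcan`) — if that tie were too weak the two integrals could differ by the non-regular set
(measure zero: fine) or by a normalisation (killed by `hcan`).  Binders = the (O2θ-W1) prefix verbatim (over-bound on purpose: same currency as (T)).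
[cite: Rogawski1990, §4.3 (4.3.1) p. 43; §4.9 p. 55] [cite: HarishChandra1999, Thm. 16.3] -/
theorem sig_K2E2WHSideIndependence :
      ∀ (L : Type) [Field L] [NumberField L] [IsCMField L] (H : Matrix (Fin 3) (Fin 3) L)
    (hH : (H.map (cmConjRingHom L))ᵀ = H) (hHd : IsUnit H.det)
    [∀ v : HeightOneSpectrum (𝓞 ↥(maximalRealSubfield L)), MeasurableSpace ((cmDatum L 3 H).Local v)]
    [∀ v : HeightOneSpectrum (𝓞 ↥(maximalRealSubfield L)),
      MeasurableSpace ((cmDatum L 2 (Matrix.of fun i j : Fin 2 => if i.val + j.val + 1 = 2 then (1 : L) else 0)).Local v ×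
        (cmDatum L 1 (Matrix.of fun i j : Fin 1 => if i.val + j.val + 1 = 1 then (1 : L) else 0)).Local v)]
    [∀ (v : HeightOneSpectrum (𝓞 ↥(maximalRealSubfield L)))
        (a : ((cmDatum L 2 (Matrix.of fun i j : Fin 2 => if i.val + j.val + 1 = 2 then (1 : L) else 0)).Local v ×
          (cmDatum L 1 (Matrix.of fun i j : Fin 1 => if i.val + j.val + 1 = 1 then (1 : L) else 0)).Local v)),
      MeasurableSpace (((cmDatum L 2 (Matrix.of fun i j : Fin 2 => if i.val + j.val + 1 = 2 then (1 : L) else 0)).Local v ×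
          (cmDatum L 1 (Matrix.of fun i j : Fin 1 => if i.val + j.val + 1 = 1 then (1 : L) else 0)).Local v) ⧸
        Subgroup.centralizer ({a} : Set ((cmDatum L 2 (Matrix.of fun i j : Fin 2 => if i.val + j.val + 1 = 2 then (1 : L) else 0)).Local v ×
          (cmDatum L 1 (Matrix.of fun i j : Fin 1 => if i.val + j.val + 1 = 1 then (1 : L) else 0)).Local v)))]
    [∀ (v : HeightOneSpectrum (𝓞 ↥(maximalRealSubfield L))) (γ : (cmDatum L 3 H).Local v),
      MeasurableSpace ((cmDatum L 3 H).Local v ⧸ Subgroup.centralizer ({γ} : Set ((cmDatum L 3 H).Local v)))]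
    (Δ : ∀ v : HeightOneSpectrum (𝓞 ↥(maximalRealSubfield L)), LocalTransferFactor L H v)
    (mH : ∀ v : HeightOneSpectrum (𝓞 ↥(maximalRealSubfield L)),
      OrbitalMeasureFamily ((cmDatum L 2 (Matrix.of fun i j : Fin 2 => if i.val + j.val + 1 = 2 then (1 : L) else 0)).Local v ×
        (cmDatum L 1 (Matrix.of fun i j : Fin 1 => if i.val + j.val + 1 = 1 then (1 : L) else 0)).Local v))
    (mG : ∀ v : HeightOneSpectrum (𝓞 ↥(maximalRealSubfield L)), OrbitalMeasureFamily ((cmDatum L 3 H).Local v))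
    (νG : ∀ v : HeightOneSpectrum (𝓞 ↥(maximalRealSubfield L)), Measure ((cmDatum L 3 H).Local v))
    (νH : ∀ v : HeightOneSpectrum (𝓞 ↥(maximalRealSubfield L)),
      Measure ((cmDatum L 2 (Matrix.of fun i j : Fin 2 => if i.val + j.val + 1 = 2 then (1 : L) else 0)).Local v ×
        (cmDatum L 1 (Matrix.of fun i j : Fin 1 => if i.val + j.val + 1 = 1 then (1 : L) else 0)).Local v))
    [∀ v : HeightOneSpectrum (𝓞 ↥(maximalRealSubfield L)), BorelSpace ((cmDatum L 3 H).Local v)]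
    [∀ v : HeightOneSpectrum (𝓞 ↥(maximalRealSubfield L)),
      BorelSpace ((cmDatum L 2 (Matrix.of fun i j : Fin 2 => if i.val + j.val + 1 = 2 then (1 : L) else 0)).Local v ×
        (cmDatum L 1 (Matrix.of fun i j : Fin 1 => if i.val + j.val + 1 = 1 then (1 : L) else 0)).Local v)]
    [∀ (v : HeightOneSpectrum (𝓞 ↥(maximalRealSubfield L)))
        (a : ((cmDatum L 2 (Matrix.of fun i j : Fin 2 => if i.val + j.val + 1 = 2 then (1 : L) else 0)).Local v ×
          (cmDatum L 1 (Matrix.of fun i j : Fin 1 => if i.val + j.val + 1 = 1 then (1 : L) else 0)).Local v)),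
      BorelSpace (((cmDatum L 2 (Matrix.of fun i j : Fin 2 => if i.val + j.val + 1 = 2 then (1 : L) else 0)).Local v ×
          (cmDatum L 1 (Matrix.of fun i j : Fin 1 => if i.val + j.val + 1 = 1 then (1 : L) else 0)).Local v) ⧸
        Subgroup.centralizer ({a} : Set ((cmDatum L 2 (Matrix.of fun i j : Fin 2 => if i.val + j.val + 1 = 2 then (1 : L) else 0)).Local v ×
          (cmDatum L 1 (Matrix.of fun i j : Fin 1 => if i.val + j.val + 1 = 1 then (1 : L) else 0)).Local v)))]
    [∀ (v : HeightOneSpectrum (𝓞 ↥(maximalRealSubfield L))) (γ : (cmDatum L 3 H).Local v),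
      BorelSpace ((cmDatum L 3 H).Local v ⧸ Subgroup.centralizer ({γ} : Set ((cmDatum L 3 H).Local v)))]
    [∀ v, (νG v).IsHaarMeasure] [∀ v, (νG v).IsMulRightInvariant] [∀ v, (νH v).IsHaarMeasure] [∀ v, (νH v).IsMulRightInvariant],
    ∀ (μω : HeckeCharacter L) (hμu : μω.IsUnitary),
    (∀ x : Literature.NumberTheory.GaloisRepresentations.ideleGroup ↥(maximalRealSubfield L),
      μω (AdeleRing.ideleBaseChange (↥(maximalRealSubfield L)) L x) = quadraticHeckeCharCM L x) →
    Δ = finExplicitCollection L H μω (finExplicitDelta_conj_left_all L H μω) (finExplicitDelta_conj_right_all L H μω) →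
    (∀ v : HeightOneSpectrum (𝓞 ↥(maximalRealSubfield L)), (mH v).IsCanonical (IsLocalGRegular L v) (νH v) ∧
      (mG v).IsCanonical (fun γ => IsRegularElt (γ.val : GL (Fin 3) (UnitaryGroup.LocalRing L v))) (νG v)) →
    CMCharIdentityPackageTestSigned L H hH hHd νH νG μω hμu Δ mH mG →
    (∀ v : HeightOneSpectrum (𝓞 ↥(maximalRealSubfield L)), (∀ w : PlacesOver L v, IsCMField.complexConj L • w.1 = w.1) →
      IsLocalDeltaTransferExists L H v (Δ v) (mH v) (mG v) Literature.NumberTheory.Rogawski1990.IsLocSmooth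
        Literature.NumberTheory.Rogawski1990.IsLocSmooth) →
    ∀ {n' : ℕ} (e₁ : Fin 3 × Fin 1 ≃ Fin n') (dV : Fin 3 → L) (hdV : ∀ i, IsCMField.complexConj L (dV i) = dV i) (hdV0 : ∀ i, dV i ≠ 0)
      (g : GL (Fin 3) L) (hg : ((g : Matrix (Fin 3) (Fin 3) L).map (cmConjRingHom L))ᵀ * H * (g : Matrix (Fin 3) (Fin 3) L) = Matrix.diagonal dV)
      (ξ : OneDimAutRepH L)
      (μ : Literature.NumberTheory.Automorphic.IdeleClassGroup L →ₜ* Circle) (hμ : IsConjugateSymplectic L μ)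
      (χf : UnitaryGroup.finAdelicOne (↥(maximalRealSubfield L)) L (IsCMField.complexConj L) →* ℂˣ),
      Continuous χf → (∀ z, ‖((χf z : ℂˣ) : ℂ)‖ = 1) →
      HasWeight L μ 1 → IsAutomorphicOneChar (↥(maximalRealSubfield L)) L (IsCMField.complexConj L) χf →
      (∀ v : HeightOneSpectrum (𝓞 ↥(maximalRealSubfield L)),
          (toHeckeCharacter L μ).semilocalComponent L v = (ξ.bcη⁻¹ * ξ.bcψ⁻¹ * μω).semilocalComponent L v) →
      (∀ z : (FiniteAdeleRing (𝓞 L) L)ˣ,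
          χf (finAdelicCheck (↥(maximalRealSubfield L)) L (IsCMField.complexConj L)
              (AlgEquiv.ext fun x => by rw [AlgEquiv.mul_apply, IsCMField.complexConj_apply_apply, AlgEquiv.one_apply]) z) =
            (ξ.bcψ⁻¹ * (ξ.bcη⁻¹ * ξ.bcψ⁻¹ * μω) ^ 2)
              (Units.map (N := AdeleRing (𝓞 L) L) (MonoidHom.inr (InfiniteAdeleRing L) (FiniteAdeleRing (𝓞 L) L)) z)) →
      ∀ (v : HeightOneSpectrum (𝓞 ↥(maximalRealSubfield L))), (∀ w : PlacesOver L v, IsCMField.complexConj L • w.1 = w.1) →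
      ∀ (T : GL (Fin 3) (LocalRing L v)) (a : LocalRing L v) (ha : IsUnit a)
        (h : formCongr (conjLocal L (IsCMField.complexConj L) v) T (H.map (algebraMap L (LocalRing L v))) =
          a • (Matrix.of fun i j : Fin 3 => if i.val + j.val + 1 = 3 then (1 : L) else 0).map (algebraMap L (LocalRing L v))),
        ∀ f fH fH',
          Literature.NumberTheory.Rogawski1990.IsLocSmooth f → Literature.NumberTheory.Rogawski1990.IsLocSmooth fH →
          Literature.NumberTheory.Rogawski1990.IsLocSmooth fH' →
          IsLocalDeltaTransfer L H v (Δ v) (mH v) (mG v) fH f → IsLocalDeltaTransfer L H v (Δ v) (mH v) (mG v) fH' f →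
          ∫ h, (((ξ.xiLocalChar v) h : ℂˣ) : ℂ) * fH h ∂(νH v) = ∫ h, (((ξ.xiLocalChar v) h : ℂˣ) : ℂ) * fH' h ∂(νH v) := by
  sorry

set_option synthInstance.maxHeartbeats 400000 in
/-- **S4 `K2E2WSupercuspidalKernelOffCompact` (crux-sized, M–L, E3-generic ∕ E2-consumed)** — Casselman–Deligne: «the character of a SUPERCUSPIDAL representation vanishes off the
compact elements»: a locally-L¹ kernel representing the character of a supercuspidal class of `U(H)(L⁺_v)` is `0` a.e. on `{γ | the closure of γ^ℤ is not compact}` (the centre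
`E¹_v` of `U(H)(L⁺_v)` is compact AT A NON-SPLIT `v` — hypothesis `hv` — so «compact modulo the centre» = compact; ED. 4 = K2E2-r01 BOX 27 REPAIR A: at a split `v`,
`U(H)(L⁺_v) ≅ GL₃(L⁺_v)` has non-compact centre and the un-guarded statement is false for every supercuspidal `π`; `hH`, `hHd` exclude the degenerate carriers).  Print: [Deligne1976
Théorème p. A155: «supp Θ_π ⊂` conjugates of compact-mod-centre elements»] ∕ [Casselman1977 Thm. 5.2: `Θ_π(g) =
Θ_{π_N}(g)` for `g` in the expanding part of a parabolic, and `π_N = 0` for supercuspidal `π`].  Rôle on the (S)-road: on the non-compact (split-torus) part of `G_v` the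
identity `± (K₁ + K₂) = E_ξ` reduces to the `πⁿ`-kernel alone (Jacquet module of `πⁿ`, ★ N3) against `E_ξ` there.  Why it might fail: the a.e.∕kernel phrasing is weaker than
print (fine); a representing kernel is unique only a.e. (row J1), so the statement is about every representing kernel — true iff true for one.
[cite: Casselman1977, Thm. 5.2] [cite: Deligne1976, Théorème p. A155] [cite: HarishChandra1999, Thm. 16.3] -/
theorem sig_K2E2WSupercuspidalKernelOffCompact :
    ∀ (L : Type) [Field L] [NumberField L] [IsCMField L] (H : Matrix (Fin 3) (Fin 3) L)
    (hH : (H.map (cmConjRingHom L))ᵀ = H) (hHd : IsUnit H.det)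
    (v : HeightOneSpectrum (𝓞 ↥(maximalRealSubfield L))), (∀ w : PlacesOver L v, IsCMField.complexConj L • w.1 = w.1) →
    ∀ [MeasurableSpace ((cmDatum L 3 H).Local v)] [BorelSpace ((cmDatum L 3 H).Local v)]
    (νG : Measure ((cmDatum L 3 H).Local v)) [νG.IsHaarMeasure],
    ∀ (c : IrrClass ((cmDatum L 3 H).Local v)), c.IsSupercuspidal →
    ∀ (K : (cmDatum L 3 H).Local v → ℂ), LocallyIntegrable K νG →
      (∀ f, Literature.NumberTheory.Rogawski1990.IsLocSmooth f → c.smoothTrace νG f = ∫ x, f x * K x ∂νG) →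
      ∀ᵐ x ∂νG, ¬ IsCompact (closure ((Subgroup.zpowers x : Subgroup ((cmDatum L 3 H).Local v)) : Set ((cmDatum L 3 H).Local v))) → K x = 0 := by
  sorry

/-! ## §3 Generic analysis rows (Mathlib-level) -/

set_option synthInstance.maxHeartbeats 400000 in
/-- **J1 `K2E2WKernelAEUnique` (support, S–M, Mathlib-level)** — «a character kernel is unique a.e.»: two locally integrable functions on `G_v = U(H)(L⁺_v)` with the same integrals
against every locally-constant compactly-supported test function agree `ν_G`-a.e.  Mechanism: indicators of compact-open subsets are test functions (★ `IsLocSmooth`); in a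
totally disconnected locally compact second-countable group they form a π-system generating the Borel σ-algebra, and a locally finite measure is determined on it (Mathlib
`MeasureTheory.Measure.ext_of_generateFrom_of_iUnion` ∕ `ae_eq_of_forall_setIntegral_eq_of_sigmaFinite`).  Used by (S) (the identity is stated a.e.) and to pass between
representing kernels in S4.  Why it might fail: needs second countability ∕ σ-finiteness of `ν_G` on `U(H)(L⁺_v)` (true: a `p`-adic Lie group; the instances are in the tree for
`(cmDatum L 3 H).Local v`).  [cite: HarishChandra1999, §2] -/
theorem sig_K2E2WKernelAEUnique :
    ∀ (L : Type) [Field L] [NumberField L] [IsCMField L] (H : Matrix (Fin 3) (Fin 3) L)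
    (v : HeightOneSpectrum (𝓞 ↥(maximalRealSubfield L)))
    [MeasurableSpace ((cmDatum L 3 H).Local v)] [BorelSpace ((cmDatum L 3 H).Local v)]
    (νG : Measure ((cmDatum L 3 H).Local v)) [νG.IsHaarMeasure],
    ∀ (K K' : (cmDatum L 3 H).Local v → ℂ), LocallyIntegrable K νG → LocallyIntegrable K' νG →
      (∀ f : (cmDatum L 3 H).Local v → ℂ, Literature.NumberTheory.Rogawski1990.IsLocSmooth f →
        ∫ x, f x * K x ∂νG = ∫ x, f x * K' x ∂νG) →
      K =ᵐ[νG] K' := by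
  sorry

/-! ## §4 Planned files NOT typable today (DEF-REQUEST rows; full text, AUDIT locators and sizes in the card's 20-row table)

* **W1 `K2E2WWeilCharacterFormula`** (E2 core, L) — DEF-REQUEST `weilCharacterKernel`: the character of the local Weil representation `ω_{ψ,χ}` of `U(W)(L⁺_v)`, `W = diag dV ⊗ ⟨ε⟩`
  (★ `(chiLocalSplittingsCM …).omegaLoc v`), is the locally-L¹ class function `x ↦ γ(ψ ∘ q_x) · |det(1 − x)|_v^{-1/2} · (χ-splitting factor)` on `{det(1 − x) ≠ 0}`
  [Howe 1973; Thomas 2008 arXiv:math/0610644 Thm. 1; Thomas 2013 ANT 7(7) §1; Adams 1998].  Intended signature: `∀ …, ∃ Θω, LocallyIntegrable Θω ν_W ∧ (∀ f, IsLocSmooth f →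
  (omegaLoc v).smoothTrace ν_W f = ∫ f·Θω) ∧ ∀ᵐ x, det(1 - x) ≠ 0 → Θω x = weilCharacterKernel … x`.
* **W2 `K2E2WThetaTypeKernelIsU1Average`** (E2 core, M–L) — «`K_c(γ) = ∫_{E¹_v} χ_v(t)⁻¹ · Θω(t · ι(γ)) dt`»: the theta-type kernel of (K) is the `U(1)`-Fourier coefficient of the
  Weil character along ★ `localLineInl` × the centre ★ `localCharOfCenter … χf v` (compact `U(1)`: the `χ_v`-coinvariants ★ `TwistedCoinv.rep` are the `χ_v`-isotypic summand)
  [GelbartRogawski1991 §3.4 p. 458; Moen 1987].  Needs W1's `Θω` as a named object (else only the abstract (K) of tier 1, already derived from E3's HC letter).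
* **W3 `K2E2WSplittingBookkeeping`** (E2, M) — the `χ`-splitting cocycle of ★ `chiLocalSplittingsCM` vs. Kudla's, and its effect on `Θω` (a character twist by `χ ∘ det`)
  [HarrisKudlaSweet1996 §1 pp. 945–950; Liu2021 Def. 4.11].
* **T1 `K2E2WWeylIntegrationG`**, **T2 `K2E2WWeylIntegrationH`** (E3-generic, L each) — Weyl integration formulas on `U(H)(L⁺_v)` and `(U(2)×U(1))(L⁺_v)` over a census of
  Cartan subgroups (DEF-REQUEST: the Cartan census as a finite family with Weyl groups and discriminants; partial ★: LH6 `weylDensity_gqs_of_ellCartanAE` for the elliptic Cartans of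
  `U(Φ₃)`) [HarishChandra1999 §4; Rogawski1990 §3.1–3.3].  (T) ⇐ T1 + T2 + T3 + HC: `E_ξ(γ) = Σ_{γ_H ↦ γ} Δ‴(γ_H, γ) ξ_v(γ_H) · D_H(γ_H)/D_G(γ)` on the regular set.
* **S1 `K2E2WTransferKernelExplicit`** (E2∕E3, M) — the explicit `E_ξ` above as a named function (DEF-REQUEST `xiTransferKernel`) + its local integrability (`|D_G|^{-1/2}` is
  locally L¹ [HarishChandra1999 Thm. 15.?; Rogawski1990 §4.9]).
* **S2 `K2E2WKernelIdentityHTori`** (E2 RESEARCH CORE, XL) — on the tori of `G_v` coming from `H_v` (types `E¹×E¹×E¹` and `E¹ × K¹_{K/E}`): `± (K_{ε₁} + K_{ε₂})(γ) = E_ξ(γ)`, i.e. the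
  sum over the two towers of the `U(1)`-averaged Weil indices `γ(ψ^{ε} ∘ q_{tγ})` reproduces Rogawski's `Δ‴ = μ`-twisted Langlands–Shelstad factor times `ξ_v` [Thomas 2013 ANT 7
  (the transfer factor of Adams's character lifting IS a Weil-representation character); Rogawski1990 §4.9 (explicit `Δ‴`, ★ `finExplicitCollection`)].  No printed proof for
  `(U(3), U(1))`; nearest print: GelbartRogawski1991 Remark p. 466 («reduces to a statement about the Howe correspondence pair (U(1), U(1)) in the local case»).
* **S3 `K2E2WKernelIdentityCubicTori`** (E2 research, L) — on the elliptic tori of type `K¹_{K/F}`, `[K:F] = 3` (no `H`-origin): `E_ξ = 0` and `K_{ε₁} + K_{ε₂} = 0` (ε-antisymmetry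
  of the Weil index under the non-norm class) [Rogawski1990 Prop. 13.1.3; Thomas 2008].
* (S) ⇐ S1 + S2 + S3 + S4 + J1 + N3-Jacquet (★ `thetaType_nonsplit_jacquetModule`) on the split-torus part.
* **R `K2E2WDepthZeroRung`** (BC5-style first rung, M–L) — the identity (S) at an UNRAMIFIED `v ∤ 2` for depth-zero data (`μ_v, χ_v` tame): `πˢ` is the cuspidal unipotent
  representation of `U(3)(L⁺_v)` and both kernels are explicit Deligne–Lusztig characters [Adler–Lansky arXiv:0807.1528 (built on [Rogawski1990]); DeBacker–Reeder] — the one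
  regime where (S) can be checked by finite-field character sums.
-/

end Summit.HodgeConjecture.HodgeConjecture.Cruxes.H413.K2E2WeilCharacterThetaRoad.Sigs

end
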